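import Summits.AnomalousDissipation.AnomalousDissipation.Theorems.ImpulseGridGridSignsCoherentTransfer

/-!
# Crux `GridSigns` (stmt-AnomalousDissipation-1771) — line `Sketch` (coherent-wake reduction): skeleton

Line `Sketch` (crux-ideate round 1, ideator 1; cards `imprint-subtraction-production-signs` remark R and
`coherent-grid-wakes-period-averages`): `GridSigns` follows from a family of time-PERIODIC classical
wakes of the grid with drift `c`, energy bounded uniformly in `j, t`, nonnegative period-mean resonant
work `∫₀^τ (G,u) ≥ 0` and a period-mean dissipation excess
`c·∫₀^τ (ν‖∇u‖² − (G,u)) + ν ∫₀^τ (u, Δ(Ψ•G)) ≥ τ·η`.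

* `stub_coherentWakes` — EXISTENCE of such a family: the single open stub (the route's physical bet
  in its sharpest, leak-free and Banach-limit-free form; it is `CoherentStates.CoherentThesis`
  (stmt-0218) specialised to grid forces with drift plus one sign, hence crux-sized).
* the TRANSFER is LANDED: `gridSigns_of_coherentWakes`
  (`Theorems/ImpulseGridGridSignsCoherentTransfer.lean`, p102745, 0 sorries).
* `GridSigns_of` — the composition, concluding the crux decl by name.
-/

noncomputable section

-- `Summit.<Summit>.<Problem>` is the tree's mandated summit-side namespace (CONVENTIONS §2); for this
-- single-conjunct summit the two coincide, so the duplicate is deliberate.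
set_option linter.dupNamespace false

open MeasureTheory Set Filter Topology
open scoped InnerProductSpace RealInnerProductSpace

namespace Summit.AnomalousDissipation.AnomalousDissipation.Theorems.ImpulseGridGridSigns

open Literature.Analysis
open Literature.Analysis.FluidPDE
open Literature.Analysis.FunctionSpaces Literature.Analysis.FunctionSpaces.Torus
open Summit.AnomalousDissipation.AnomalousDissipation.Theses.ImpulseGrid

/-- **Stub (existence; the physical bet of route ImpulseGrid, line `Sketch`).** Loud coherent grid
wakes: a slab⊗transverse design `(Φ, Ψ, G, c, η)` with the design clauses of `GridSigns`, and a
vanishing-viscosity family of classical, time-periodic solutions `u j` (period `τ j > 0`, pressure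
`p j`) of the Navier–Stokes system on `ℝ × 𝕋³` forced by `Φ•G`, with drift data `∫ u j 0 = c e₀`,
energy `∫‖u j t‖² ≤ E` uniformly in `j, t`, nonnegative period-mean resonant work and period-mean
dissipation excess `≥ η`. (Exactly the hypothesis of the landed `gridSigns_of_coherentWakes`.) [folklore] -/
theorem stub_coherentWakes :
    ∃ (Φ Ψ : UnitAddTorus (Fin 3) → ℝ) (G : UnitAddTorus (Fin 3) → EuclideanSpace ℝ (Fin 3)) (c η : ℝ),
      IsSmooth Φ ∧ IsSmooth Ψ ∧ IsSmooth G ∧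
      (∀ (s : UnitAddCircle) x, Ψ (x + Pi.single (1 : Fin 3) s) = Ψ x ∧ Ψ (x + Pi.single (2 : Fin 3) s) = Ψ x) ∧
      (∀ (s : UnitAddCircle) x, G (x + Pi.single (0 : Fin 3) s) = G x) ∧ (∀ x, G x 0 = 0) ∧ IsDivFree G ∧
      (∀ x, Torus.partialDeriv 0 Ψ x = Φ x - 1) ∧ (∫ x, Φ x * Ψ x * ‖G x‖ ^ 2 = 0) ∧
      IsSmooth (fun x => Φ x • G x) ∧ IsDivFree (fun x => Φ x • G x) ∧ HasZeroMean (fun x => Φ x • G x) ∧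
      0 < c ∧ 0 < η ∧
      ∃ (ν τ : ℕ → ℝ) (u : ℕ → ℝ → UnitAddTorus (Fin 3) → EuclideanSpace ℝ (Fin 3))
        (p : ℕ → ℝ → UnitAddTorus (Fin 3) → ℝ),
        (∀ j, 0 < ν j) ∧ Tendsto ν atTop (nhds 0) ∧
        (∀ j, FunctionSpaces.Torus.IsClassicalNSSolutionOn Set.univ (ν j) (fun _ => fun x => Φ x • G x) (u j) (p j) ∧
          0 < τ j ∧ Function.Periodic (u j) (τ j)) ∧
        (∀ j, ∫ x, u j 0 x = c • EuclideanSpace.single 0 1) ∧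
        (∃ E : ℝ, ∀ j t, ∫ x, ‖u j t x‖ ^ 2 ≤ E) ∧
        (∀ j, 0 ≤ ∫ t in (0 : ℝ)..τ j, ∫ x, ⟪G x, u j t x⟫) ∧
        (∀ j, τ j * η ≤ c * (∫ t in (0 : ℝ)..τ j, (ν j * gradNormSq (u j t) - ∫ x, ⟪G x, u j t x⟫))
            + ν j * (∫ t in (0 : ℝ)..τ j, ∫ x, ⟪u j t x, Torus.laplacian (fun y => Ψ y • G y) x⟫)) := by
  sorry

/-- **Composition** (line `Sketch`): the coherent-wake existence stub and the landed transfer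
`gridSigns_of_coherentWakes` conclude the crux `GridSigns` (stmt-AnomalousDissipation-1771) by
name. [folklore] -/
theorem GridSigns_of : GridSigns :=
  gridSigns_of_coherentWakes stub_coherentWakes

end Summit.AnomalousDissipation.AnomalousDissipation.Theorems.ImpulseGridGridSigns

end
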